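import Mathlib
import HarnessLib
import Summits.NavierStokesRegularity.NavierStokesRegularity.Theorems.AxisTwistDoorAveragedConeLiouvillePositivityStep

/-!
# Route `AxisTwistDoor`, crux `AveragedConeLiouville` (stmt-NavierStokesRegularity-26889), line `lrt_shell` —
# discharging `PositivityPropagationFactC` WITHOUT Nazarov–Ural'tseva, brick P5: THE HARNACK CHAIN OF SMALL BALLS

Iterating the density-one spreading step of brick P2 (`spread_step`: `V(s) ≥ μ` on `B̄(p, h)` gives
`V(s+τ) ≥ c⋆μ` on `B̄(p, 2h)` for `h² ≤ τ ≤ 2h²`, `8Λh ≤ c⋆`) along a chain of centres `p₀, p₁, …, pₙ` with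
consecutive distances `≤ h` inside the unit cylinder: `V(s₀) ≥ μ` on `B̄(p₀, h)` gives `V(s₀ + nτ) ≥ c⋆ⁿ μ` on
`B̄(pₙ, h)` (`chain`).  Plus the two pieces of arithmetic the final assembly needs to reach a prescribed point at a
prescribed time: `exists_nat_steps` (a number of steps `n` with `h² ≤ D/n ≤ 2h²` and `2/n ≤ h` for a time lapse
`D ≥ 2h + 2h²`) and `segment_point_*` (the equally spaced points `q + (i/n)(x − q)` of a segment).

Seat ns-atd-p1 (LEAD g2).  WHAT THIS IS NOT: not a statement about Navier–Stokes regularity; linear parabolic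
comparison estimates serving a STAGED door route.  Lands `--supports` the crux item as a helper.
-/

noncomputable section

-- the summit and its single sub-problem share the name (CONVENTIONS §1), as in every Theorems file
set_option linter.dupNamespace false

namespace Summit.NavierStokesRegularity.NavierStokesRegularity.Theorems.AveragedConeLiouville.PositivityChain

open scoped InnerProductSpace ENNReal Laplacian Topology NNReal
open Set Function MeasureTheory Metric Filter Real
open Summit.NavierStokesRegularity.NavierStokesRegularity.Theorems.AveragedConeLiouville.PositivityStep

/-! ### The chain -/

/-- **The Harnack chain.**  There are universal constants `0 < c⋆ < 1`, `N⋆ ≥ 3` (those of `spread_step`) such that: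
for `V` of class `C²` on an open `U ⊇ [0,T] × B̄(0,1)`, `V ≥ 0` and `∂ₜV − ΔV + ⟪b, ∇V⟫ ≥ 0` with `|b| ≤ Λ`
(`Λ ≥ 0`) on `(0,T) × B(0,1)`; for `h > 0` with `8Λh ≤ c⋆`, `h² ≤ τ ≤ 2h²`, centres `p₀, …, pₙ` with
`B̄(pᵢ, N⋆h) ⊆ B(0,1)` and `dist(pᵢ₊₁, pᵢ) ≤ h`, and times `0 < s₀`, `s₀ + nτ < T`: if `V(s₀) ≥ μ ≥ 0` on `B̄(p₀, h)`
then `V(s₀ + nτ) ≥ c⋆ⁿ μ` on `B̄(pₙ, h)`. -/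
theorem chain : ∃ cstar Nstar : ℝ, 0 < cstar ∧ cstar < 1 ∧ 3 ≤ Nstar ∧
    ∀ (V : ℝ → EuclideanSpace ℝ (Fin 3) → ℝ) (b : ℝ → EuclideanSpace ℝ (Fin 3) → EuclideanSpace ℝ (Fin 3))
      (U : Set (ℝ × EuclideanSpace ℝ (Fin 3))) (T Λ h τ μ s₀ : ℝ) (p : ℕ → EuclideanSpace ℝ (Fin 3)) (n : ℕ),
      IsOpen U → Icc 0 T ×ˢ closedBall (0 : EuclideanSpace ℝ (Fin 3)) 1 ⊆ U → ContDiffOn ℝ 2 (uncurry V) U →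
      0 ≤ Λ →
      (∀ t ∈ Ioo 0 T, ∀ x ∈ ball (0 : EuclideanSpace ℝ (Fin 3)) 1, ‖b t x‖ ≤ Λ) →
      (∀ t ∈ Ioo 0 T, ∀ x ∈ ball (0 : EuclideanSpace ℝ (Fin 3)) 1, 0 ≤ V t x) →
      (∀ t ∈ Ioo 0 T, ∀ x ∈ ball (0 : EuclideanSpace ℝ (Fin 3)) 1,
        0 ≤ deriv (fun σ => V σ x) t - (Δ (V t)) x + ⟪b t x, gradient (V t) x⟫_ℝ) →
      0 < h → 8 * Λ * h ≤ cstar → h ^ 2 ≤ τ → τ ≤ 2 * h ^ 2 → 0 ≤ μ → 0 < s₀ → s₀ + n * τ < T →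
      (∀ i ≤ n, closedBall (p i) (Nstar * h) ⊆ ball (0 : EuclideanSpace ℝ (Fin 3)) 1) →
      (∀ i < n, dist (p (i + 1)) (p i) ≤ h) →
      (∀ x ∈ closedBall (p 0) h, μ ≤ V s₀ x) →
      ∀ x ∈ closedBall (p n) h, cstar ^ n * μ ≤ V (s₀ + n * τ) x := by
  obtain ⟨cstar, Nstar, hc0, hc1, hN3, hstep⟩ := spread_step
  refine ⟨cstar, Nstar, hc0, hc1, hN3, ?_⟩
  intro V b U T Λ h τ μ s₀ p n hU hUsub hV hΛ hb hV0 hsup hh hΛh hτ1 hτ2 hμ hs₀ hT hballs hdist hinit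
  have hτ0 : 0 ≤ τ := le_trans (sq_nonneg h) hτ1
  -- induction along the chain
  have key : ∀ i : ℕ, i ≤ n → ∀ x ∈ closedBall (p i) h, cstar ^ i * μ ≤ V (s₀ + i * τ) x := by
    intro i
    induction i with
    | zero =>
      intro _ x hx
      simpa using hinit x hx
    | succ i ih =>
      intro hi x hx
      have hi' : i ≤ n := Nat.le_of_succ_le hi
      set s : ℝ := s₀ + i * τ with hs
      have hs0 : 0 < s := by rw [hs]; positivity
      have hsτ : s + τ = s₀ + ((i + 1 : ℕ) : ℝ) * τ := by rw [hs]; push_cast; ring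
      have hsT : s + τ < T := by
        rw [hsτ]
        have : ((i + 1 : ℕ) : ℝ) * τ ≤ (n : ℝ) * τ :=
          mul_le_mul_of_nonneg_right (by exact_mod_cast hi) hτ0
        linarith
      have hB := hballs i hi'
      -- the cylinder `[s, s+τ] × B̄(pᵢ, N⋆h)` lies in the unit cylinder
      have hWsub : Icc s (s + τ) ×ˢ closedBall (p i) (Nstar * h) ⊆ U := by
        rintro ⟨t, y⟩ ⟨ht, hy⟩
        exact hUsub ⟨⟨le_trans hs0.le ht.1, le_trans ht.2 hsT.le⟩, ball_subset_closedBall (hB hy)⟩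
      have hIoc : ∀ t ∈ Ioc s (s + τ), t ∈ Ioo 0 T := fun t ht => ⟨lt_trans hs0 ht.1, lt_of_le_of_lt ht.2 hsT⟩
      have hIcc : ∀ t ∈ Icc s (s + τ), t ∈ Ioo 0 T :=
        fun t ht => ⟨lt_of_lt_of_le hs0 ht.1, lt_of_le_of_lt ht.2 hsT⟩
      have hb' : ∀ t ∈ Ioc s (s + τ), ∀ y ∈ ball (p i) (Nstar * h), ‖b t y‖ ≤ Λ :=
        fun t ht y hy => hb t (hIoc t ht) y (hB (ball_subset_closedBall hy))
      have hV0' : ∀ t ∈ Icc s (s + τ), ∀ y ∈ closedBall (p i) (Nstar * h), 0 ≤ V t y :=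
        fun t ht y hy => hV0 t (hIcc t ht) y (hB hy)
      have hsup' : ∀ t ∈ Ioc s (s + τ), ∀ y ∈ ball (p i) (Nstar * h),
          0 ≤ deriv (fun σ => V σ y) t - (Δ (V t)) y + ⟪b t y, gradient (V t) y⟫_ℝ :=
        fun t ht y hy => hsup t (hIoc t ht) y (hB (ball_subset_closedBall hy))
      have hx' : x ∈ closedBall (p i) (2 * h) := by
        rw [mem_closedBall]
        calc dist x (p i) ≤ dist x (p (i + 1)) + dist (p (i + 1)) (p i) := dist_triangle _ _ _
          _ ≤ h + h := add_le_add (mem_closedBall.1 hx) (hdist i hi)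
          _ = 2 * h := by ring
      have hmain := hstep V b U (p i) s τ h Λ (cstar ^ i * μ) hU hWsub hV hΛ hΛh hb' hV0' hsup' hh hτ1 hτ2
        (by positivity) (ih hi') x hx'
      rw [hsτ] at hmain
      calc cstar ^ (i + 1) * μ = cstar * (cstar ^ i * μ) := by ring
        _ ≤ _ := hmain
  exact key n le_rfl

/-! ### Arithmetic of the chain: number of steps, points of a segment -/

/-- **Number of steps.**  For `0 < h` and a time lapse `D ≥ 2h + 2h²` there is `n ≥ 1` with `h² ≤ D/n ≤ 2h²`,
`2/n ≤ h` and `n ≤ D/h²` (take `n = ⌊D/h²⌋`). -/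
theorem exists_nat_steps {h D : ℝ} (hh : 0 < h) (hD : 2 * h + 2 * h ^ 2 ≤ D) :
    ∃ n : ℕ, 1 ≤ n ∧ h ^ 2 ≤ D / n ∧ D / n ≤ 2 * h ^ 2 ∧ 2 / (n : ℝ) ≤ h ∧ (n : ℝ) ≤ D / h ^ 2 := by
  have hh2 : 0 < h ^ 2 := by positivity
  have hD0 : 0 < D := by nlinarith
  set n : ℕ := ⌊D / h ^ 2⌋₊ with hn
  have hnle : (n : ℝ) ≤ D / h ^ 2 := Nat.floor_le (by positivity)
  have hnlt : D / h ^ 2 < n + 1 := Nat.lt_floor_add_one _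
  have hDh : 2 ≤ D / h ^ 2 := by
    rw [le_div_iff₀ hh2]; nlinarith
  have hn1 : 1 ≤ n := by
    have h1 : (1 : ℝ) < (n : ℝ) + 1 := by linarith
    have h2 : (0 : ℝ) < n := by linarith
    have h3 : 0 < n := by exact_mod_cast h2
    exact h3
  have hn0 : (0 : ℝ) < n := by exact_mod_cast hn1
  refine ⟨n, hn1, ?_, ?_, ?_, hnle⟩
  · -- `h² ≤ D/n` from `n ≤ D/h²`
    rw [le_div_iff₀ hn0]
    have := (le_div_iff₀ hh2).1 hnle
    linarith
  · -- `D/n ≤ 2h²` from `D/h² < n + 1 ≤ 2n`... precisely `D < (n+1)h²` and `D ≥ 2h²` give `D ≤ 2nh²`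
    rw [div_le_iff₀ hn0]
    have h1 : D < ((n : ℝ) + 1) * h ^ 2 := by
      have := (div_lt_iff₀ hh2).1 hnlt; linarith
    have h2 : 2 * h ^ 2 ≤ D := by nlinarith
    -- if `D > 2 n h²` then `2nh² < (n+1)h²`, i.e. `n < 1`, contradiction
    nlinarith
  · -- `2/n ≤ h` from `n > D/h² − 1 ≥ 2/h`
    rw [div_le_iff₀ hn0]
    have h1 : D / h ^ 2 - 1 < n := by linarith
    have h2 : 2 / h ≤ D / h ^ 2 - 1 := by
      rw [div_le_iff₀ hh, sub_mul, div_mul_eq_mul_div, le_sub_iff_add_le]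
      rw [le_div_iff₀ hh2]
      nlinarith
    have h3 : 2 / h < n := lt_of_le_of_lt h2 h1
    have := (div_lt_iff₀ hh).1 h3
    linarith

/-- The points `q + (i/n)(x − q)` of the segment `[q, x]`: at `i = 0` the point `q`. -/
theorem segment_point_zero (q x : EuclideanSpace ℝ (Fin 3)) (n : ℕ) :
    q + ((0 : ℕ) / (n : ℝ)) • (x - q) = q := by simp

/-- The points `q + (i/n)(x − q)` of the segment `[q, x]`: at `i = n ≠ 0` the point `x`. -/
theorem segment_point_last (q x : EuclideanSpace ℝ (Fin 3)) {n : ℕ} (hn : n ≠ 0) :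
    q + ((n : ℕ) / (n : ℝ)) • (x - q) = x := by
  rw [div_self (Nat.cast_ne_zero.2 hn), one_smul]; abel

/-- Consecutive points of the segment are `‖x − q‖/n` apart. -/
theorem dist_segment_point_succ (q x : EuclideanSpace ℝ (Fin 3)) (n i : ℕ) (hn : n ≠ 0) :
    dist (q + (((i + 1 : ℕ) : ℝ) / (n : ℝ)) • (x - q)) (q + ((i : ℝ) / (n : ℝ)) • (x - q)) = ‖x - q‖ / n := by
  rw [dist_eq_norm, add_sub_add_left_eq_sub, ← sub_smul, norm_smul]
  have : ((i + 1 : ℕ) : ℝ) / (n : ℝ) - (i : ℝ) / (n : ℝ) = 1 / (n : ℝ) := by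
    push_cast; field_simp; ring
  rw [this, Real.norm_of_nonneg (by positivity)]
  ring

/-- The points of the segment stay within `max ‖q‖ ‖x‖` of the origin (convexity of the norm). -/
theorem norm_segment_point_le (q x : EuclideanSpace ℝ (Fin 3)) {n i : ℕ} (hn : n ≠ 0) (hi : i ≤ n) :
    ‖q + ((i : ℝ) / (n : ℝ)) • (x - q)‖ ≤ max ‖q‖ ‖x‖ := by
  set θ : ℝ := (i : ℝ) / (n : ℝ) with hθ
  have hn0 : (0 : ℝ) < n := by exact_mod_cast Nat.pos_of_ne_zero hn
  have hθ0 : 0 ≤ θ := by positivity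
  have hθ1 : θ ≤ 1 := by rw [hθ, div_le_one hn0]; exact_mod_cast hi
  have heq : q + θ • (x - q) = (1 - θ) • q + θ • x := by
    rw [smul_sub, sub_smul, one_smul]; abel
  rw [heq]
  calc ‖(1 - θ) • q + θ • x‖ ≤ ‖(1 - θ) • q‖ + ‖θ • x‖ := norm_add_le _ _
    _ = (1 - θ) * ‖q‖ + θ * ‖x‖ := by
        rw [norm_smul, norm_smul, Real.norm_of_nonneg hθ0, Real.norm_of_nonneg (by linarith)]
    _ ≤ (1 - θ) * max ‖q‖ ‖x‖ + θ * max ‖q‖ ‖x‖ :=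
        add_le_add (mul_le_mul_of_nonneg_left (le_max_left _ _) (by linarith))
          (mul_le_mul_of_nonneg_left (le_max_right _ _) hθ0)
    _ = max ‖q‖ ‖x‖ := by ring

end Summit.NavierStokesRegularity.NavierStokesRegularity.Theorems.AveragedConeLiouville.PositivityChain

end
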